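import Literature.Geometry.Riemannian.GromovW1Triangle
import HarnessLib

/-!
# The average distance of a metric measure space is `2`-Lipschitz in `d_{GW₁}` (Bamler 2023,
# §4.2, Lemma)

R. Bamler, *Compactness theory of the space of super Ricci flows*, Invent. Math. 233 (2023), §4.2,
the Lemma stating that *"closeness of two metric measure spaces in the `GW₁`-sense implies
smallness of"* the difference of average distances: *"Let `(Xᵢ, dᵢ, μᵢ)`, `i = 1, 2`, be two metric
measure spaces. Then
`|∫_{X₁}∫_{X₁} d₁ dμ₁ dμ₁ − ∫_{X₂}∫_{X₂} d₂ dμ₂ dμ₂| ≤ 2 d_{GW₁}((X₁, d₁, μ₁), (X₂, d₂, μ₂))`"*.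
Printed proof: for isometric embeddings `φᵢ : Xᵢ → Z` and a coupling `q`,
`∫∫ d₁ dμ₁ dμ₁ − ∫∫ d₂ dμ₂ dμ₂ = ∫∫ (d₁(x₁, y₁) − d₂(x₂, y₂)) dq(y₁, y₂) dq(x₁, x₂)` and
`|d₁(x₁, y₁) − d₂(x₂, y₂)| ≤ d_Z(φ₁ x₁, φ₂ x₂) + d_Z(φ₁ y₁, φ₂ y₂)`. We prove it for the tree's
`gromovW1` (`GromovW1Distance.lean`) in the one-sided `[0, ∞]`-valued form
`∫∫ d₁ dμ₁ dμ₁ ≤ ∫∫ d₂ dμ₂ dμ₂ + 2 d_{GW₁}` (apply it twice, with `gromovW1_comm`, for the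
absolute value), the couplings being pulled back to `X₁ × X₂` (`IsCoupling.comap_prodMap`), where
all integrands are measurable:

* `lintegral_lintegral_edist_le_add_two_mul_lintegral` — the estimate for one pair of embeddings
  and one coupling;
* `lintegral_lintegral_edist_le_add_two_mul_gromovW1` — **the Lemma**.

Everything is proved; no definitions, no named facts.

## References

* R. H. Bamler, *Compactness theory of the space of super Ricci flows*, Invent. Math. 233 (2023),
  §4.2, Lemma (`|∫∫ d₁ − ∫∫ d₂| ≤ 2 d_{GW₁}`). [Bamler2023]
-/

noncomputable section

open Set MeasureTheory Filter Topology
open scoped ENNReal NNReal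

namespace Literature.Geometry.Riemannian

universe u

variable {X₁ X₂ : Type u} [MetricSpace X₁] [MeasurableSpace X₁] [BorelSpace X₁]
  [SecondCountableTopology X₁] [CompleteSpace X₁] [MetricSpace X₂] [MeasurableSpace X₂]
  [BorelSpace X₂] [SecondCountableTopology X₂] [CompleteSpace X₂]

/-- **The average distance changes by at most twice the transport cost** (Bamler 2023, §4.2,
proof of the Lemma): for isometric embeddings `φᵢ : Xᵢ → Z` of complete separable metric spaces,
probability measures `μᵢ` and a coupling `q` of `(φ₁)_* μ₁, (φ₂)_* μ₂` on `Z × Z`,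
`∫∫ d₁ dμ₁ dμ₁ ≤ ∫∫ d₂ dμ₂ dμ₂ + 2 ∫ d_Z dq` — with the pull-back `q̃` of `q` to `X₁ × X₂`:
`∫∫ d₁ dμ₁ dμ₁ = ∫∫ d₁(x₁, y₁) dq̃ dq̃ ≤ ∫∫ (d₂(x₂, y₂) + d_Z(φ₁ x₁, φ₂ x₂) + d_Z(φ₁ y₁, φ₂ y₂)) dq̃ dq̃`.
[cite: Bamler2023, §4.2, Lemma (|∫∫ d₁ − ∫∫ d₂| ≤ 2 d_{GW₁}), proof] -/
theorem lintegral_lintegral_edist_le_add_two_mul_lintegral {Z : Type*} [MetricSpace Z]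
    [MeasurableSpace Z] [BorelSpace Z] {φ₁ : X₁ → Z} {φ₂ : X₂ → Z} (hφ₁ : Isometry φ₁)
    (hφ₂ : Isometry φ₂) (μ₁ : Measure X₁) (μ₂ : Measure X₂) [IsProbabilityMeasure μ₁]
    [IsProbabilityMeasure μ₂] {q : Measure (Z × Z)} (hq : IsCoupling (μ₁.map φ₁) (μ₂.map φ₂) q) :
    ∫⁻ x, ∫⁻ y, edist x y ∂μ₁ ∂μ₁ ≤
      ∫⁻ x, ∫⁻ y, edist x y ∂μ₂ ∂μ₂ + 2 * ∫⁻ z, edist z.1 z.2 ∂q := by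
  have hme₁ : MeasurableEmbedding φ₁ := hφ₁.isClosedEmbedding.measurableEmbedding
  have hme₂ : MeasurableEmbedding φ₂ := hφ₂.isClosedEmbedding.measurableEmbedding
  obtain ⟨⟨hqP, hq1, hq2⟩, hmap⟩ := hq.comap_prodMap hme₁ hme₂
  set q' : Measure (X₁ × X₂) := q.comap (Prod.map φ₁ φ₂) with hq'
  haveI := hqP
  -- the cost of `q`, read upstairs
  have hcost : ∫⁻ p, edist (φ₁ p.1) (φ₂ p.2) ∂q' = ∫⁻ z, edist z.1 z.2 ∂q := by
    have h := (hme₁.prodMap hme₂).lintegral_map (μ := q') (fun z : Z × Z ↦ edist z.1 z.2)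
    rw [hmap] at h
    rw [h]
    rfl
  -- measurability upstairs
  have hc : Measurable fun p : X₁ × X₂ ↦ edist (φ₁ p.1) (φ₂ p.2) :=
    ((hφ₁.continuous.comp continuous_fst).edist (hφ₂.continuous.comp continuous_snd)).measurable
  have hF₁ : Measurable fun z : X₁ × (X₁ × X₂) ↦ edist z.1 z.2.1 :=
    (continuous_fst.edist continuous_snd.fst).measurable
  have hF₂ : Measurable fun z : X₂ × (X₁ × X₂) ↦ edist z.1 z.2.2 :=
    (continuous_fst.edist continuous_snd.snd).measurable
  have hG₁ : Measurable fun x : X₁ ↦ ∫⁻ p', edist x p'.1 ∂q' := hF₁.lintegral_prod_right'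
  have hG₂ : Measurable fun x : X₂ ↦ ∫⁻ p', edist x p'.2 ∂q' := hF₂.lintegral_prod_right'
  have hin₂ : Measurable fun p : X₁ × X₂ ↦ ∫⁻ p', edist p.2 p'.2 ∂q' := hG₂.comp measurable_snd
  have hrow : ∀ p : X₁ × X₂, Measurable fun p' : X₁ × X₂ ↦ edist p.2 p'.2 := fun p ↦
    (continuous_const.edist continuous_snd).measurable
  -- `∫∫ dᵢ dμᵢ dμᵢ = ∫∫ dᵢ dq' dq'` through the marginals of `q'`
  have hA₁ : ∫⁻ x, ∫⁻ y, edist x y ∂μ₁ ∂μ₁ = ∫⁻ p, ∫⁻ p', edist p.1 p'.1 ∂q' ∂q' := by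
    have hin : ∀ x : X₁, ∫⁻ y, edist x y ∂μ₁ = ∫⁻ p', edist x p'.1 ∂q' := fun x ↦ by
      conv_lhs => rw [← hq1, Measure.fst]
      exact lintegral_map (show Measurable (fun y : X₁ ↦ edist x y) from
        (continuous_const.edist continuous_id).measurable) measurable_fst
    simp_rw [hin]
    conv_lhs => rw [← hq1, Measure.fst]
    exact lintegral_map hG₁ measurable_fst
  have hA₂ : ∫⁻ x, ∫⁻ y, edist x y ∂μ₂ ∂μ₂ = ∫⁻ p, ∫⁻ p', edist p.2 p'.2 ∂q' ∂q' := by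
    have hin : ∀ x : X₂, ∫⁻ y, edist x y ∂μ₂ = ∫⁻ p', edist x p'.2 ∂q' := fun x ↦ by
      conv_lhs => rw [← hq2, Measure.snd]
      exact lintegral_map (show Measurable (fun y : X₂ ↦ edist x y) from
        (continuous_const.edist continuous_id).measurable) measurable_snd
    simp_rw [hin]
    conv_lhs => rw [← hq2, Measure.snd]
    exact lintegral_map hG₂ measurable_snd
  -- the pointwise estimate (triangle inequality in `Z`)
  have hpt : ∀ p p' : X₁ × X₂, edist p.1 p'.1 ≤
      edist p.2 p'.2 + (edist (φ₁ p.1) (φ₂ p.2) + edist (φ₁ p'.1) (φ₂ p'.2)) := fun p p' ↦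
    calc edist p.1 p'.1 = edist (φ₁ p.1) (φ₁ p'.1) := (hφ₁.edist_eq _ _).symm
      _ ≤ edist (φ₁ p.1) (φ₂ p.2) + edist (φ₂ p.2) (φ₂ p'.2) + edist (φ₂ p'.2) (φ₁ p'.1) :=
          edist_triangle4 _ _ _ _
      _ = edist p.2 p'.2 + (edist (φ₁ p.1) (φ₂ p.2) + edist (φ₁ p'.1) (φ₂ p'.2)) := by
          rw [hφ₂.edist_eq, edist_comm (φ₂ p'.2)]
          ring
  set C : ℝ≥0∞ := ∫⁻ p', edist (φ₁ p'.1) (φ₂ p'.2) ∂q' with hC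
  rw [hA₁, hA₂, ← hcost]
  calc ∫⁻ p, ∫⁻ p', edist p.1 p'.1 ∂q' ∂q'
      ≤ ∫⁻ p, ∫⁻ p', edist p.2 p'.2 + (edist (φ₁ p.1) (φ₂ p.2) + edist (φ₁ p'.1) (φ₂ p'.2)) ∂q' ∂q' :=
        lintegral_mono fun p ↦ lintegral_mono fun p' ↦ hpt p p'
    _ = ∫⁻ p, (∫⁻ p', edist p.2 p'.2 ∂q' + (edist (φ₁ p.1) (φ₂ p.2) + C)) ∂q' := by
        refine lintegral_congr fun p ↦ ?_
        rw [lintegral_add_left (hrow p), lintegral_add_left measurable_const, lintegral_const,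
          measure_univ, mul_one]
    _ = ∫⁻ p, ∫⁻ p', edist p.2 p'.2 ∂q' ∂q' + (C + C) := by
        rw [lintegral_add_left hin₂, lintegral_add_left hc, lintegral_const, measure_univ, mul_one]
    _ = ∫⁻ p, ∫⁻ p', edist p.2 p'.2 ∂q' ∂q' + 2 * C := by rw [two_mul]

/-- **The average distance is `2`-Lipschitz in `d_{GW₁}`** (Bamler 2023, §4.2, Lemma:
`|∫∫ d₁ dμ₁ dμ₁ − ∫∫ d₂ dμ₂ dμ₂| ≤ 2 d_{GW₁}((X₁, d₁, μ₁), (X₂, d₂, μ₂))`), one-sided `[0, ∞]`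
form for probability measures on complete separable metric spaces:
`∫∫ d₁ dμ₁ dμ₁ ≤ ∫∫ d₂ dμ₂ dμ₂ + 2 d_{GW₁}` (the other side follows by symmetry,
`gromovW1_comm`). [cite: Bamler2023, §4.2, Lemma (|∫∫ d₁ − ∫∫ d₂| ≤ 2 d_{GW₁})] -/
theorem lintegral_lintegral_edist_le_add_two_mul_gromovW1 (μ₁ : Measure X₁) (μ₂ : Measure X₂)
    [IsProbabilityMeasure μ₁] [IsProbabilityMeasure μ₂] :
    ∫⁻ x, ∫⁻ y, edist x y ∂μ₁ ∂μ₁ ≤ ∫⁻ x, ∫⁻ y, edist x y ∂μ₂ ∂μ₂ + 2 * gromovW1 μ₁ μ₂ := by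
  have h2 : (2 : ℝ≥0∞) ≠ 0 := two_ne_zero
  have h2' : (2 : ℝ≥0∞) ≠ ∞ := ENNReal.ofNat_ne_top
  have key : ∀ (Z : Type u) [MetricSpace Z] [MeasurableSpace Z] [BorelSpace Z] (φ₁ : X₁ → Z)
      (φ₂ : X₂ → Z), Isometry φ₁ → Isometry φ₂ →
      ∫⁻ x, ∫⁻ y, edist x y ∂μ₁ ∂μ₁ ≤
        ∫⁻ x, ∫⁻ y, edist x y ∂μ₂ ∂μ₂ + 2 * wassersteinW1 (μ₁.map φ₁) (μ₂.map φ₂) := by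
    intro Z _ _ _ φ₁ φ₂ hφ₁ hφ₂
    rw [wassersteinW1, ENNReal.mul_iInf_of_ne h2 h2', ENNReal.add_iInf]
    exact le_iInf fun q ↦ lintegral_lintegral_edist_le_add_two_mul_lintegral hφ₁ hφ₂ μ₁ μ₂ q.2
  rw [gromovW1]
  simp only [ENNReal.mul_iInf_of_ne h2 h2', ENNReal.add_iInf]
  refine le_iInf fun Z ↦ le_iInf fun _ ↦ le_iInf fun φ₁ ↦ le_iInf fun φ₂ ↦ le_iInf fun hφ₁ ↦
    le_iInf fun hφ₂ ↦ ?_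
  letI : MeasurableSpace Z := borel Z
  haveI : BorelSpace Z := ⟨rfl⟩
  exact key Z φ₁ φ₂ hφ₁ hφ₂

end Literature.Geometry.Riemannian

end
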